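import Summits.BirchSwinnertonDyer.BirchSwinnertonDyer.Theorems.EisensteinPrimesFullDescentOrdinaryKernel
import Literature.NumberTheory.GaloisRepresentations.ModPCyclotomicCharacterInertiaSurjective
import Literature.NumberTheory.EllipticCurves.SelmerCorankControlRatProofs
import Literature.NumberTheory.EllipticCurves.IsogenyFrobeniusTraceProofs
import Literature.NumberTheory.EllipticCurves.LFunctionPrimeCoeff
import Literature.NumberTheory.EllipticCurves.AnalyticRankLSeriesSummableProofs
import Literature.NumberTheory.DiophantineGeometry.Conductor
import HarnessLib

/-!
# Over `ℚ` at a good ordinary odd prime `p`: the kernels `Λ ≤ E[p]`, `K₂ ≤ E[p²]` of reduction, and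
# **the decomposition group at `p` cannot act trivially on `E[p²]/K₂`** (`#Ẽ(𝔽_p) ≤ 2p + 1 < p²`)

Cell `bsd-eis`, seat `bsd-line-x1-p1-w4` gen 6 (width seat on crux 2 `GoodLatticeBDPValue`,
stmt-BirchSwinnertonDyer-19032, line `halves` v21). ROUTE-FREE helper (`--supports` the crux): brick **F3
part 3/3** of the AN-3 Stub B road toward the registered stub `stub_fullDescentAtThreeOfRed` (w3 g4's memo
`AN3-StubB-elementary-road.md` §4 F3; steps A3-at-3 and A5 of the elementary `E[9]` proof of Theorem T″):
the `ℚ`, `p` odd specialisation of `exists_ordinary_reduction_kernels` (`…FullDescentOrdinaryKernel`).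
THEOREMS ONLY (no definition, no named fact, no `sorry`); nothing here closes a stub or proves a summit
statement.

* `Rat.exists_mem_absInertia_modNCyclotomicCharacter_absGaloisRestrict_eq` — every `u : (ℤ/p)ˣ` is
  `χ̄_p(res τ)` for some `τ` in the inertia group `absInertia ℚ_v` of the place `v` of `p` (tree theorem
  `Rat.exists_mem_absInertia_adicCompletion_modPCyclotomicCharacterZMod_eq`, `ℚ_v(ζ_p)/ℚ_v` totally
  ramified, transported by `modPCyclotomicCharacterZMod_absGaloisRestrict`).
* `Rat.exists_ordinary_reduction_kernels` — for `W/ℚ` elliptic, `p` an ODD prime, `v` the place of `p`,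
  good ordinary reduction at `v` (`p ∤ a_v`): subgroups `Λ ≤ E[p]` (`#p`), `K₂ ≤ E[p²]` (`#p²`,
  `K₂ ⊓ E[p] = Λ`), stable under `res : Γ_{ℚ_v} → Γ_ℚ`, inertia trivial on `E[p]/Λ` and `E[p²]/K₂` and
  acting on `K₂` through `χ̄_{p²}` and on `Λ` through `χ̄_p`, and **`¬ (∀ σ ∈ Γ_{ℚ_v}, ∀ x ∈ E[p²],
  res σ • x − x ∈ K₂)`**: otherwise `p² ≤ #Ẽ_v(𝔽_p) ≤ 2p + 1` (`natCard_point_le_two_mul_card_add_one`),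
  absurd for `p ≥ 3` (the memo's «α ≡ 7 or 4 (mod 9), never 1», here without Hasse).
* `Rat.exists_ordinary_reduction_kernels_of_hasGoodReductionAtPrime` — the same keyed on the prime-indexed
  API of a globally minimal `W` (`HasGoodReductionAtPrime p`, `p ∤ W.frobeniusTrace p`; bridges
  `hasGoodReductionAt_of_hasGoodReductionAtPrime`, `frobeniusTraceAt_eq_frobeniusTrace`).

Consumer (w3 g4's F7, Theorem A): with `L ≤ E[9]` the `Γ_ℚ`-stable cyclic subgroup of order `9` and
`L = K₂` at `3`, inertia at `3` acts on `L` by `ε mod 9`, so `χ_L ε⁻¹` is unramified everywhere, hence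
trivial, hence `Γ_ℚ` — in particular `Γ_{ℚ₃}` — acts trivially on `E[9]/L = E[9]/K₂`: contradiction.

References: [SerreInventiones1972] §1.11 Prop. 11, Cor., §1.8 Prop. 8; [SerreLocalFields1979] IV §4
Prop. 17–18; [SilvermanAEC2009] VII.2.1, VII.3.1, V.1.1 (proof), Ex. 5.10.
-/

set_option linter.dupNamespace false
set_option autoImplicit false

noncomputable section

open scoped Classical NNReal NumberField AddSubgroup
open NumberField IsDedekindDomain

namespace Summit.BirchSwinnertonDyer.BirchSwinnertonDyer.Theorems.FullDescentOrdinaryNine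

open _root_.WeierstrassCurve Literature.NumberTheory.EllipticCurves
  Literature.NumberTheory.GaloisRepresentations Field IsDedekindDomain.HeightOneSpectrum
  Rat.HeightOneSpectrum

/-- **Inertia at `p` maps onto `(ℤ/p)ˣ` under `χ̄_p ∘ res`.** For the place `v` of `ℚ` above the prime `p`
and every `u : (ℤ/p)ˣ` there is `τ ∈ I_{ℚ_v} = absInertia ℚ_v` with `χ̄_p(res τ) = u`, `χ̄_p` the mod `p`
cyclotomic character of `Γ_ℚ` and `res = absGaloisRestrict ℚ ℚ_v` (`ℚ_v(ζ_p)/ℚ_v` is totally ramified with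
group `(ℤ/p)ˣ`: tree `Rat.exists_mem_absInertia_adicCompletion_modPCyclotomicCharacterZMod_eq`, and
`χ̄_p(res τ) = χ̄_p^{ℚ_v}(τ)`). [cite: SerreLocalFields1979, Ch. IV §4, Prop. 17 (ii)(iii) and Prop. 18]
[cite: SerreInventiones1972, §1.7 and §1.8 Prop. 8, Cor.] -/
theorem Rat.exists_mem_absInertia_modNCyclotomicCharacter_absGaloisRestrict_eq
    (p : ℕ) [hp : Fact p.Prime] (v : HeightOneSpectrum (𝓞 ℚ)) (hpv : (p : 𝓞 ℚ) ∈ v.asIdeal)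
    (u : (ZMod p)ˣ) :
    ∃ τ ∈ absInertia (v.adicCompletion ℚ),
      modNCyclotomicCharacter ℚ p (absGaloisRestrict ℚ (v.adicCompletion ℚ) τ) = u := by
  haveI : CharZero (v.adicCompletion ℚ) :=
    charZero_of_injective_algebraMap (algebraMap ℚ (v.adicCompletion ℚ)).injective
  haveI : NeZero ((p : ℕ) : v.adicCompletion ℚ) := NeZero.charZero
  obtain ⟨τ, hτ, h⟩ := Rat.exists_mem_absInertia_adicCompletion_modPCyclotomicCharacterZMod_eq v
    (primesEquiv_eq_of_natCast_mem v hp.out hpv) u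
  refine ⟨τ, hτ, ?_⟩
  -- `χ̄_p^ℚ(res τ) = χ̄_p^{ℚ_v}(τ)` (restriction compatibility, for the `adicCompletion` algebra structure)
  have hres := @modPCyclotomicCharacterZMod_absGaloisRestrict ℚ (v.adicCompletion ℚ) _ _
    (IsDedekindDomain.HeightOneSpectrum.instAlgebraAdicCompletion (𝓞 ℚ) ℚ v) p _ _ _ τ
  rw [h] at hres
  rw [← hres]
  rfl

/-- **The ordinary kernels over `ℚ` at an odd prime, and the non-triviality of `Γ_{ℚ_p}` on `E[p²]/K₂`.**
Let `W/ℚ` be an elliptic curve, `p` an odd prime, `v` the place of `ℚ` above `p`, of good ORDINARY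
reduction (`p ∤ a_v`). Then there are subgroups `Λ ≤ E[p]`, `K₂ ≤ E[p²]` of `E(ℚ̄)` with `#Λ = p`,
`#K₂ = p²`, `K₂ ⊓ E[p] = Λ`, both stable under `res : Γ_{ℚ_v} → Γ_ℚ`, such that the inertia group
`absInertia ℚ_v` acts trivially on `E[p]/Λ` and on `E[p²]/K₂`, on `K₂` through `χ̄_{p²} ∘ res` and on `Λ`
through `χ̄_p ∘ res`, and such that **NOT every `σ ∈ Γ_{ℚ_v}` acts trivially on `E[p²]/K₂`** — else the
`p²` points of `E[p²]/K₂ ↪ Ẽ(𝔽̄_p)` would be `𝔽_p`-rational, but `#Ẽ(𝔽_p) ≤ 2p + 1 < p²`.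
(`exists_ordinary_reduction_kernels` with its inertia hypothesis discharged by
`Rat.exists_mem_absInertia_modNCyclotomicCharacter_absGaloisRestrict_eq` at `u = -1 ≠ 1`.) Serre 1972 §1.11
Prop. 11, Cor.; memo A3-at-3, A5. [cite: SerreInventiones1972, §1.11 Prop. 11 and Cor.]
[cite: SilvermanAEC2009, Prop. VII.2.1, VII.3.1, Ex. 5.10] -/
theorem Rat.exists_ordinary_reduction_kernels (W : WeierstrassCurve ℚ) [W.IsElliptic]
    (p : ℕ) [hp : Fact p.Prime] (hp2 : p ≠ 2)
    (v : HeightOneSpectrum (𝓞 ℚ)) (hpv : (p : 𝓞 ℚ) ∈ v.asIdeal) (hgood : W.HasGoodReductionAt v)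
    (hord : ¬ ((p : ℤ) ∣ W.frobeniusTraceAt v)) :
    ∃ Λ K₂ : AddSubgroup (geomPoints W),
      Λ ≤ geomTorsion W p ∧ Nat.card Λ = p ∧
      K₂ ≤ geomTorsion W (p ^ 2 : ℕ) ∧ Nat.card K₂ = p ^ 2 ∧ K₂ ⊓ geomTorsion W p = Λ ∧
      (∀ (τ : absoluteGaloisGroup (v.adicCompletion ℚ)), ∀ x ∈ Λ,
        absGaloisRestrict ℚ (v.adicCompletion ℚ) τ • x ∈ Λ) ∧
      (∀ (τ : absoluteGaloisGroup (v.adicCompletion ℚ)), ∀ x ∈ K₂,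
        absGaloisRestrict ℚ (v.adicCompletion ℚ) τ • x ∈ K₂) ∧
      (∀ τ ∈ absInertia (v.adicCompletion ℚ), ∀ x ∈ geomTorsion W p,
        absGaloisRestrict ℚ (v.adicCompletion ℚ) τ • x - x ∈ Λ) ∧
      (∀ τ ∈ absInertia (v.adicCompletion ℚ), ∀ x ∈ geomTorsion W (p ^ 2 : ℕ),
        absGaloisRestrict ℚ (v.adicCompletion ℚ) τ • x - x ∈ K₂) ∧
      (∀ τ ∈ absInertia (v.adicCompletion ℚ), ∀ x ∈ K₂,
        absGaloisRestrict ℚ (v.adicCompletion ℚ) τ • x =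
          ((modNCyclotomicCharacter ℚ (p ^ 2) (absGaloisRestrict ℚ (v.adicCompletion ℚ) τ) :
            (ZMod (p ^ 2))ˣ) : ZMod (p ^ 2)).val • x) ∧
      (∀ τ ∈ absInertia (v.adicCompletion ℚ), ∀ x ∈ Λ,
        absGaloisRestrict ℚ (v.adicCompletion ℚ) τ • x =
          ((modNCyclotomicCharacter ℚ p (absGaloisRestrict ℚ (v.adicCompletion ℚ) τ) :
            (ZMod p)ˣ) : ZMod p).val • x) ∧
      ¬ (∀ (σ : absoluteGaloisGroup (v.adicCompletion ℚ)), ∀ x ∈ geomTorsion W (p ^ 2 : ℕ),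
          absGaloisRestrict ℚ (v.adicCompletion ℚ) σ • x - x ∈ K₂) := by
  have hpp : p.Prime := hp.out
  -- an inertia element with `χ̄_p(res τ) = -1 ≠ 1`
  have hτ : ∃ τ ∈ absInertia (v.adicCompletion ℚ),
      modNCyclotomicCharacter ℚ p (absGaloisRestrict ℚ (v.adicCompletion ℚ) τ) ≠ 1 := by
    obtain ⟨τ, hτ, h⟩ :=
      Rat.exists_mem_absInertia_modNCyclotomicCharacter_absGaloisRestrict_eq p v hpv (-1)
    refine ⟨τ, hτ, ?_⟩
    rw [h]
    haveI : Fact (2 < p) := ⟨lt_of_le_of_ne hpp.two_le (Ne.symm hp2)⟩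
    intro h1
    exact ZMod.neg_one_ne_one (n := p) (by
      have := congrArg (fun w : (ZMod p)ˣ ↦ (w : ZMod p)) h1
      simpa using this)
  obtain ⟨Λ, K₂, h1, h2, h3, h4, h5, h6, h7, h8, h9, h10, h11, h12⟩ :=
    Theorems.FullDescentOrdinaryNine.exists_ordinary_reduction_kernels W p v hpv hgood hord hτ
  refine ⟨Λ, K₂, h1, h2, h3, h4, h5, h6, h7, h8, h9, h10, h11, fun hD ↦ ?_⟩
  have hle := h12 hD
  -- `#Ẽ_v(𝔽_p) ≤ 2p + 1 < p²`
  letI : Fintype (IsLocalRing.ResidueField (v.adicCompletionIntegers ℚ)) := Fintype.ofFinite _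
  have hq : Fintype.card (IsLocalRing.ResidueField (v.adicCompletionIntegers ℚ)) = p := by
    rw [← Nat.card_eq_fintype_card, natCard_residueField_adicCompletionIntegers v,
      primesEquiv_eq_of_natCast_mem v hpp hpv]
  have hbd := (W.reductionAt v).natCard_point_le_two_mul_card_add_one
  rw [hq] at hbd
  have h3p : 3 ≤ p := lt_of_le_of_ne hpp.two_le (Ne.symm hp2)
  have : p ^ 2 ≤ 2 * p + 1 := hle.trans hbd
  nlinarith

/-- **The same, keyed on the prime-indexed API of a globally minimal equation.** For `W/ℚ` elliptic and
globally minimal, `p` an odd prime of good reduction (`HasGoodReductionAtPrime p`) with `p ∤ a_p`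
(`W.frobeniusTrace p`), and any place `v ∋ p` of `ℚ`: the conclusion of
`Rat.exists_ordinary_reduction_kernels` (bridges `hasGoodReductionAt_of_hasGoodReductionAtPrime` and
`frobeniusTraceAt_eq_frobeniusTrace`). [cite: SerreInventiones1972, §1.11 Prop. 11 and Cor.]
[cite: SilvermanAEC2009, Prop. VII.5.1(a), VII.1.3(b)] -/
theorem Rat.exists_ordinary_reduction_kernels_of_hasGoodReductionAtPrime
    (W : WeierstrassCurve ℚ) [W.IsElliptic] [W.IsGloballyMinimal]
    (p : ℕ) [hp : Fact p.Prime] (hp2 : p ≠ 2) (hgood : W.HasGoodReductionAtPrime p)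
    (hord : ¬ ((p : ℤ) ∣ W.frobeniusTrace p))
    (v : HeightOneSpectrum (𝓞 ℚ)) (hpv : (p : 𝓞 ℚ) ∈ v.asIdeal) :
    ∃ Λ K₂ : AddSubgroup (geomPoints W),
      Λ ≤ geomTorsion W p ∧ Nat.card Λ = p ∧
      K₂ ≤ geomTorsion W (p ^ 2 : ℕ) ∧ Nat.card K₂ = p ^ 2 ∧ K₂ ⊓ geomTorsion W p = Λ ∧
      (∀ (τ : absoluteGaloisGroup (v.adicCompletion ℚ)), ∀ x ∈ Λ,
        absGaloisRestrict ℚ (v.adicCompletion ℚ) τ • x ∈ Λ) ∧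
      (∀ (τ : absoluteGaloisGroup (v.adicCompletion ℚ)), ∀ x ∈ K₂,
        absGaloisRestrict ℚ (v.adicCompletion ℚ) τ • x ∈ K₂) ∧
      (∀ τ ∈ absInertia (v.adicCompletion ℚ), ∀ x ∈ geomTorsion W p,
        absGaloisRestrict ℚ (v.adicCompletion ℚ) τ • x - x ∈ Λ) ∧
      (∀ τ ∈ absInertia (v.adicCompletion ℚ), ∀ x ∈ geomTorsion W (p ^ 2 : ℕ),
        absGaloisRestrict ℚ (v.adicCompletion ℚ) τ • x - x ∈ K₂) ∧
      (∀ τ ∈ absInertia (v.adicCompletion ℚ), ∀ x ∈ K₂,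
        absGaloisRestrict ℚ (v.adicCompletion ℚ) τ • x =
          ((modNCyclotomicCharacter ℚ (p ^ 2) (absGaloisRestrict ℚ (v.adicCompletion ℚ) τ) :
            (ZMod (p ^ 2))ˣ) : ZMod (p ^ 2)).val • x) ∧
      (∀ τ ∈ absInertia (v.adicCompletion ℚ), ∀ x ∈ Λ,
        absGaloisRestrict ℚ (v.adicCompletion ℚ) τ • x =
          ((modNCyclotomicCharacter ℚ p (absGaloisRestrict ℚ (v.adicCompletion ℚ) τ) :
            (ZMod p)ˣ) : ZMod p).val • x) ∧
      ¬ (∀ (σ : absoluteGaloisGroup (v.adicCompletion ℚ)), ∀ x ∈ geomTorsion W (p ^ 2 : ℕ),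
          absGaloisRestrict ℚ (v.adicCompletion ℚ) σ • x - x ∈ K₂) := by
  have hgood' : W.HasGoodReductionAt v := W.hasGoodReductionAt_of_hasGoodReductionAtPrime v hpv hgood
  have hord' : ¬ ((p : ℤ) ∣ W.frobeniusTraceAt v) := by
    rw [W.frobeniusTraceAt_eq_frobeniusTrace v, primesEquiv_eq_of_natCast_mem v hp.out hpv]
    exact hord
  exact Rat.exists_ordinary_reduction_kernels W p hp2 v hpv hgood' hord'

end Summit.BirchSwinnertonDyer.BirchSwinnertonDyer.Theorems.FullDescentOrdinaryNine

end
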